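import Summits.CriticalPhenomena.PercolationContinuityZ3.Theorems.SahiMasterFamilyFInequalityAMSCutBound

/-!
# Unconditional Kleitman-type bounds behind the strengthened Kleitman conjecture (KC): the cut bound and the component bound

Support file for the master-family `F`-inequality programme (`prim-master-conj` gen 27; `--supports stmt-CriticalPhenomena-4575`;
memo `run/shared/lean/prim/prim-l12/prim-master-conj/POINTWISE.md` §28).  No definition, no `sorry`, standard axioms.

Setting (`TwistedAD.KCWeighted`, POINTWISE §26): `V ⊆ Y` upper families of the cube, `T = Y ∖ V`, `SameComp T` the comparability components of
`T`, and the cross-component antipodal points `S = {x ∈ T : xᶜ ∈ T, ¬SameComp T x xᶜ}` (so `ccWeight ω T = Σ_{x∈S} ω x`).  (KC) conjectures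
`ccWeight ω T ≤ 2·Σ_{v ∈ V, vᶜ ∉ Y} ω v` ("coherent pairs outweigh cross-component pairs"); it is OPEN, implies `F_comb ≥ 0` on
`G ⊆ A ∪ B` (`weightedFcomb_nonneg_of_KC_of_subset_union`), and follows from (AMS) (`KCWeighted_of_AMSWeighted`).

NEW here (instance-wise and unconditional), for every complement-invariant FKG weight `ω ≥ 0`:
* `sum_amsUnions_cc_le_sum_coherent` — the admissible unions of the (AMS)-instance `(S, SameComp T)` are coherent points:
  `Σ_{u ∈ J(S, SameComp T)} ω u ≤ Σ_{v ∈ V ∖ Yᶜˢ} ω v`;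
* `kc_cut_bound` — **cut bound**: for ANY colouring `χ` of `T` that is constant on comparability components,
  `Σ_{x ∈ S, χ xᶜ ≠ χ x} ω x ≤ 2·Σ_{v ∈ V ∖ Yᶜˢ} ω v` — the cross-component pairs CUT by `χ` are outweighed by the coherent pairs
  (for the bipartition "one component versus the rest" this is Kleitman's lemma for `(V ∪ K, V ∪ (T∖K))`; here for every bipartition);
* `kc_of_separating_colouring` — hence the (KC) inequality `ccWeight ω T ≤ 2·Σ_{V∖Yᶜˢ} ω` holds for `(V,Y)` whenever some component-colouring
  separates every cross-component antipodal pair, i.e. whenever the component LINK GRAPH of `T` is bipartite (POINTWISE §26 (V4)(b),(c):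
  this covers every instance in dimension ≤ 5, where the link graph is always bipartite; odd cycles appear from dimension 6);
* `sum_component_cc_le_sum_coherent` — **component bound**: for any antipode-free union of components `g`,
  `Σ_{x ∈ S, g x} ω x ≤ Σ_{v ∈ V∖Yᶜˢ} ω v`; `kc_of_dominant_component` — (KC) holds when such a `g` carries half of `ccWeight`.

So the open content of (KC) is exactly the maxcut defect of non-bipartite link graphs (first instance: the `Z₃`-symmetric family in
dimension 6 of POINTWISE §26 (S1), where `cc = 6`, maxcut `= 4`, `coh = 7`).

HONEST FRAMING: unconditional special cases of an OPEN conjecture of this programme. [this work]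
-/

namespace Summit.CriticalPhenomena.PercolationContinuityZ3.Theorems

namespace TwistedAD

open Finset
open scoped FinsetFamily Classical

variable {κ : Type*} [Fintype κ] [DecidableEq κ]

/-- The cross-component antipodal points of `T = Y ∖ V` form a complement-closed family on which `SameComp T` never relates a point to
its complement. [this work] -/
theorem ccPoints_compl_mem (T : Finset (Finset κ)) {x : Finset κ}
    (hx : x ∈ T.filter (fun x => xᶜ ∈ T ∧ ¬ SameComp T x xᶜ)) :
    xᶜ ∈ T.filter (fun x => xᶜ ∈ T ∧ ¬ SameComp T x xᶜ) := by
  have hequiv : Equivalence (SameComp T) := Relation.EqvGen.is_equivalence _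
  rw [mem_filter] at hx ⊢
  obtain ⟨hxT, hxcT, hns⟩ := hx
  refine ⟨hxcT, ?_, ?_⟩
  · rw [compl_compl]; exact hxT
  · rw [compl_compl]; exact fun hsame => hns (hequiv.symm hsame)

/-- `ccWeight ω (Y∖V)` is the weight of the cross-component antipodal points. [this work] -/
theorem ccWeight_eq_sum_ccPoints (ω : Finset κ → ℝ) (T : Finset (Finset κ)) :
    ccWeight ω T = ∑ x ∈ T.filter (fun x => xᶜ ∈ T ∧ ¬ SameComp T x xᶜ), ω x := by
  unfold ccWeight; rw [sum_filter]

/-- **Admissible unions of cross-component points are coherent.**  For upper `V ⊆ Y`, `T = Y ∖ V`, `S` the cross-component antipodal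
points and `R = SameComp T`: `Σ_{u ∈ J(S,R)} ω u ≤ Σ_{v ∈ V∖Yᶜˢ} ω v` for `ω ≥ 0` (each admissible union `x ∪ z` lies in `V` with
`(x ∪ z)ᶜ = xᶜ ∩ zᶜ ∉ Y`, and distinct unions are distinct coherent points). [this work] -/
theorem sum_amsUnions_cc_le_sum_coherent (ω : Finset κ → ℝ) (hω₀ : ∀ s, 0 ≤ ω s) (V Y : Finset (Finset κ))
    (hV : IsUpperSet (V : Set (Finset κ))) (hY : IsUpperSet (Y : Set (Finset κ))) :
    ∑ u ∈ amsUnions ((Y \ V).filter (fun x => xᶜ ∈ Y \ V ∧ ¬ SameComp (Y \ V) x xᶜ)) (SameComp (Y \ V)), ω u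
      ≤ ∑ v ∈ V \ Yᶜˢ, ω v := by
  set T : Finset (Finset κ) := Y \ V with hT
  set S : Finset (Finset κ) := T.filter (fun x => xᶜ ∈ T ∧ ¬ SameComp T x xᶜ) with hS
  have hJsub : amsUnions S (SameComp T) ⊆ V \ Yᶜˢ := by
    intro u hu
    unfold amsUnions at hu
    rw [mem_image] at hu
    obtain ⟨p, hp, rfl⟩ := hu
    rw [mem_filter, mem_product] at hp
    obtain ⟨⟨hp1, hp2⟩, hn12, hnc12⟩ := hp
    have hp1T : p.1 ∈ T := (mem_filter.1 hp1).1
    have hp2T : p.2 ∈ T := (mem_filter.1 hp2).1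
    have hp1cT : p.1ᶜ ∈ T := ((mem_filter.1 hp1).2).1
    have hp2cT : p.2ᶜ ∈ T := ((mem_filter.1 hp2).2).1
    rw [mem_sdiff, mem_compls, Finset.compl_union]
    exact ⟨union_mem_of_not_sameComp V Y hY hp1T hp2T hn12, inter_not_mem_of_not_sameComp V Y hV hp1cT hp2cT hnc12⟩
  exact sum_le_sum_of_subset_of_nonneg hJsub fun s _ _ => hω₀ s

/-- **Cut bound for (KC) (unconditional).**  Let `ω ≥ 0` be complement-invariant with the FKG lattice condition, `V ⊆ Y` upper families,
`T = Y ∖ V`, and `χ : Finset κ → Bool` a colouring of `T` constant on comparability components (`SameComp T x z → χ x = χ z` on `T`).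
Then the cross-component antipodal points whose pair is CUT by `χ` weigh at most twice the coherent points:
`Σ_{x ∈ T, xᶜ ∈ T, ¬SameComp T x xᶜ, χ xᶜ ≠ χ x} ω x ≤ 2·Σ_{v ∈ V∖Yᶜˢ} ω v`. [this work] -/
theorem kc_cut_bound (ω : Finset κ → ℝ) (hω₀ : ∀ s, 0 ≤ ω s)
    (hω : ∀ s t, ω s * ω t ≤ ω (s ⊓ t) * ω (s ⊔ t)) (hsym : ∀ s, ω sᶜ = ω s)
    (V Y : Finset (Finset κ)) (hV : IsUpperSet (V : Set (Finset κ))) (hY : IsUpperSet (Y : Set (Finset κ)))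
    (χ : Finset κ → Bool) (hχ : ∀ x ∈ Y \ V, ∀ z ∈ Y \ V, SameComp (Y \ V) x z → χ x = χ z) :
    ∑ x ∈ ((Y \ V).filter (fun x => xᶜ ∈ Y \ V ∧ ¬ SameComp (Y \ V) x xᶜ)).filter (fun x => χ xᶜ ≠ χ x), ω x
      ≤ 2 * ∑ v ∈ V \ Yᶜˢ, ω v := by
  set T : Finset (Finset κ) := Y \ V with hT
  set S : Finset (Finset κ) := T.filter (fun x => xᶜ ∈ T ∧ ¬ SameComp T x xᶜ) with hS
  have hScl : ∀ x ∈ S, xᶜ ∈ S := fun x hx => ccPoints_compl_mem T hx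
  have hRχ : ∀ x ∈ S, ∀ z ∈ S, SameComp T x z → χ x = χ z :=
    fun x hx z hz h => hχ x (mem_filter.1 hx).1 z (mem_filter.1 hz).1 h
  have h1 := sum_crossing_le_two_mul_sum_amsUnions ω hω₀ hω hsym S (SameComp T) hScl χ hRχ
  have h2 := sum_amsUnions_cc_le_sum_coherent ω hω₀ V Y hV hY
  linarith

/-- **(KC) for bipartite link graphs (unconditional).**  If some component-colouring `χ` of `T = Y∖V` separates every cross-component
antipodal pair (`χ xᶜ ≠ χ x` whenever `x, xᶜ ∈ T` lie in different components), then
`ccWeight ω (Y∖V) ≤ 2·Σ_{v ∈ V∖Yᶜˢ} ω v` — the (KC) inequality for `(V,Y)`, for every complement-invariant FKG weight `ω ≥ 0`.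
[this work] -/
theorem kc_of_separating_colouring (ω : Finset κ → ℝ) (hω₀ : ∀ s, 0 ≤ ω s)
    (hω : ∀ s t, ω s * ω t ≤ ω (s ⊓ t) * ω (s ⊔ t)) (hsym : ∀ s, ω sᶜ = ω s)
    (V Y : Finset (Finset κ)) (hV : IsUpperSet (V : Set (Finset κ))) (hY : IsUpperSet (Y : Set (Finset κ)))
    (χ : Finset κ → Bool) (hχ : ∀ x ∈ Y \ V, ∀ z ∈ Y \ V, SameComp (Y \ V) x z → χ x = χ z)
    (hsep : ∀ x ∈ Y \ V, xᶜ ∈ Y \ V → ¬ SameComp (Y \ V) x xᶜ → χ xᶜ ≠ χ x) :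
    ccWeight ω (Y \ V) ≤ 2 * ∑ v ∈ V \ Yᶜˢ, ω v := by
  have h := kc_cut_bound ω hω₀ hω hsym V Y hV hY χ hχ
  rw [ccWeight_eq_sum_ccPoints]
  have heq : ((Y \ V).filter (fun x => xᶜ ∈ Y \ V ∧ ¬ SameComp (Y \ V) x xᶜ)).filter (fun x => χ xᶜ ≠ χ x)
      = (Y \ V).filter (fun x => xᶜ ∈ Y \ V ∧ ¬ SameComp (Y \ V) x xᶜ) := by
    apply filter_true_of_mem
    intro x hx
    rw [mem_filter] at hx
    exact hsep x hx.1 hx.2.1 hx.2.2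
  rw [heq] at h
  exact h

/-- **Component bound (unconditional).**  For an antipode-free, component-closed set of points `g` of `T = Y∖V` (e.g. ONE comparability
component, or any union of components containing no cross-component antipodal pair):
`Σ_{x ∈ T, xᶜ ∈ T, ¬SameComp T x xᶜ, g x} ω x ≤ Σ_{v ∈ V∖Yᶜˢ} ω v` — the coherent points outweigh the cross-component antipodal
points inside `g`. [this work] -/
theorem sum_component_cc_le_sum_coherent (ω : Finset κ → ℝ) (hω₀ : ∀ s, 0 ≤ ω s)
    (hω : ∀ s t, ω s * ω t ≤ ω (s ⊓ t) * ω (s ⊔ t)) (hsym : ∀ s, ω sᶜ = ω s)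
    (V Y : Finset (Finset κ)) (hV : IsUpperSet (V : Set (Finset κ))) (hY : IsUpperSet (Y : Set (Finset κ)))
    (g : Finset κ → Bool) (hg : ∀ x ∈ Y \ V, ∀ z ∈ Y \ V, SameComp (Y \ V) x z → g x = g z)
    (hanti : ∀ x ∈ Y \ V, xᶜ ∈ Y \ V → ¬ SameComp (Y \ V) x xᶜ → g x = true → g xᶜ = false) :
    ∑ x ∈ ((Y \ V).filter (fun x => xᶜ ∈ Y \ V ∧ ¬ SameComp (Y \ V) x xᶜ)).filter (fun x => g x = true), ω x
      ≤ ∑ v ∈ V \ Yᶜˢ, ω v := by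
  set T : Finset (Finset κ) := Y \ V with hT
  set S : Finset (Finset κ) := T.filter (fun x => xᶜ ∈ T ∧ ¬ SameComp T x xᶜ) with hS
  have hScl : ∀ x ∈ S, xᶜ ∈ S := fun x hx => ccPoints_compl_mem T hx
  have hRg : ∀ x ∈ S, ∀ z ∈ S, SameComp T x z → g x = g z :=
    fun x hx z hz h => hg x (mem_filter.1 hx).1 z (mem_filter.1 hz).1 h
  have hanti' : ∀ x ∈ S, g x = true → g xᶜ = false := by
    intro x hx hgx
    rw [mem_filter] at hx
    exact hanti x hx.1 hx.2.1 hx.2.2 hgx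
  have h1 := sum_class_le_sum_amsUnions ω hω₀ hω hsym S (SameComp T) hScl g hRg hanti'
  have h2 := sum_amsUnions_cc_le_sum_coherent ω hω₀ V Y hV hY
  linarith

/-- **(KC) for a dominant component (unconditional).**  If an antipode-free, component-closed `g` carries at least half of `ccWeight ω (Y∖V)`,
then the (KC) inequality holds for `(V,Y)`. [this work] -/
theorem kc_of_dominant_component (ω : Finset κ → ℝ) (hω₀ : ∀ s, 0 ≤ ω s)
    (hω : ∀ s t, ω s * ω t ≤ ω (s ⊓ t) * ω (s ⊔ t)) (hsym : ∀ s, ω sᶜ = ω s)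
    (V Y : Finset (Finset κ)) (hV : IsUpperSet (V : Set (Finset κ))) (hY : IsUpperSet (Y : Set (Finset κ)))
    (g : Finset κ → Bool) (hg : ∀ x ∈ Y \ V, ∀ z ∈ Y \ V, SameComp (Y \ V) x z → g x = g z)
    (hanti : ∀ x ∈ Y \ V, xᶜ ∈ Y \ V → ¬ SameComp (Y \ V) x xᶜ → g x = true → g xᶜ = false)
    (hdom : ccWeight ω (Y \ V)
      ≤ 2 * ∑ x ∈ ((Y \ V).filter (fun x => xᶜ ∈ Y \ V ∧ ¬ SameComp (Y \ V) x xᶜ)).filter (fun x => g x = true), ω x) :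
    ccWeight ω (Y \ V) ≤ 2 * ∑ v ∈ V \ Yᶜˢ, ω v := by
  have h := sum_component_cc_le_sum_coherent ω hω₀ hω hsym V Y hV hY g hg hanti
  linarith

end TwistedAD

end Summit.CriticalPhenomena.PercolationContinuityZ3.Theorems
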